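/-
Copyright (c) 2026 the pub-hodgecm-mathlib formalisation cell (harness21).  Prover seat hodgecm-mathlib-LH4-p01 (g6): LH4-plan (g6) WORD #55 (P3′) «TRACE-FRAME ALGEBRA»
(the Lean certificate of §2 of `F0/P3c/LH4/LH4-p01/g6/CENSUS-M1-flicker-scalars.v1.md` bf2b9cff8e6aee20 = FINDING OF RECORD #4); 2026-09-02.
-/
import Literature.NumberTheory.Rogawski1990.UnitFundamentalLemmaInertFlickerTorus     -- ★ the sibling §1: `twistGram`, `Φ₃`-spelling, `etaDiag_eq_diagonal`, `det_flickerFrame` (Flicker's `P₁`, `e = ½`)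
import Mathlib.Topology.Algebra.Valued.ValuationTopology
import HarnessLib

/-!
# The TRACE FRAME `Q_b = (1 0 1; 0 1 0; b 0 −σb)`, `b + σb = 1`: a `½`-free integral eigenframe for Flicker's type-(1) torus in `U(Φ₃)`, its literal
# `t₁^{(b)} = Q_b·diag(a, m, c)·Q_b⁻¹`, unitarity, characteristic polynomial, the `π`-twisted class `t_π^{(b)}`, and the depth of `t₁^{(b)} − 1`
# (Flicker 1998 §2 Prop. 3; Jacobowitz 1962 §7 (the trace condition); Rogawski 1990 §3.5–§3.6)

Topic `NumberTheory/Rogawski1990`; namespace `Literature.NumberTheory.Rogawski1990`.  THEOREMS ONLY (no definition, no instance, no notation, no named fact, no `sorry`);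
count-neutral; kernel lane `--supports stmt-HodgeConjecture-24833`.  Cell `pub/hodgecm-mathlib` (D-0151), crux H413 = `stmt-HodgeConjecture-24833`, half A line LH4 (dyadic pay-down;
(D-UNR) PRINT by ruling D74′), LEAD T13-42 price list, LH4-plan (g6) WORD #55: FINDING OF RECORD #4 «M1 (Flicker scalars) = L; `e = ½`, `x x̄ = 2`, `y ȳ = −2`, `σe = e` and the
parity of `ord_v 2` are artefacts of Flicker's frame `P₁ = (1 0 1; 0 1 0; −1 0 1)` (Gram `diag(−2,1,2)`, `det 2`, ★ sibling :111∕:116), eliminated by the trace frame».  THIS FILE is the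
ring-level certificate, the twin of ★ `UnitFundamentalLemmaInertFlickerTorus` §1 with `e = ½` REPLACED by any `b` with `b + σb = 1` (at odd places `b = ½` is allowed; at an
inert-unramified dyadic place `b ∈ 𝒪_w` exists by ★ `WildSeamDockings` (K1) ∕ ★ `UnramifiedQuadraticUnitTrace` ∕ `UnramifiedLocalConjDatum.trace`).  HONEST READER LABEL: BANKED
base layer, consumers none live (the M1 re-base is undealt); HC_CM is proved only modulo the 7 printed citations (2 remaining named inputs: hLiu418 = stmt-HodgeConjecture-24832,
h413 = stmt-HodgeConjecture-24833) until rung 0 closes; pure commutative algebra, pays no organ, opens no road.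

CONTENTS (any `CommRing R`, `σ : R →+* R`; the valued § any `Field K` with `Valued K Γ₀`):
* (T1) `twistGram_traceFrame`: `ᵗσ(Q_b)·Φ₃·Q_b = diag(1, 1, −1)` (`σσ = id`, `b + σb = 1`) — UNIT lengths, no `2`;  `det_traceFrame`: `det Q_b = −(b + σb)` (`= −1`).
* (T2) `traceFrame_mul_inv`, `inv_mul_traceFrame`: `Q_b · (σb 0 1; 0 1 0; b 0 −1) = 1` and the reverse — an INTEGRAL inverse, no `½` (`exists_generalLinearGroup_traceFrame`).
* (T3) the literal `t₁^{(b)} := (aσb + cb, 0, a − c; 0, m, 0; bσb(a − c), 0, ab + cσb)`: `traceTorusElt_mul_frame` (`t₁^{(b)}·Q_b = Q_b·diag(a, m, c)`),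
  `traceTorusElt_eq_conj`, **`traceTorusElt_unitary`** (`ᵗσ(t₁^{(b)})·Φ₃·t₁^{(b)} = Φ₃` for norm-one `a, m, c` — the twin of ★ :87 `flickerTorusElt_one_unitary` WITHOUT `h2`∕`hσe`).
* (T4) `charpoly_traceTorusElt = (X − a)(X − m)(X − c)` (when `b + σb` is a unit, e.g. `= 1`).
* (T5) the `π`-class: `twistGram_diag_mul_traceFrame` (`diag(π,1,1)·Q_b` has Gram `diag(π, 1, −π)` for `σπ = π`: sign vector `(1,0,1)` relative to `Q_b`, Flicker's `t_π` pattern read on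
  «`π ∉ N`» alone), `diag_mul_traceTorusElt` (`diag(π,1,1)·t₁^{(b)} = t_π^{(b)}·diag(π,1,1)`, `t_π^{(b)} = (aσb + cb, 0, π(a − c); 0, m, 0; π′bσb(a − c), 0, ab + cσb)`, twin of ★ :124),
  `traceTorusEltPi_unitary`.
* (T6) depth: `traceTorusElt_sub_one` (the entrywise identity `t₁^{(b)} − 1 = ((a−1)σb + (c−1)b, 0, a − c; 0, m − 1, 0; bσb(a − c), 0, (a−1)b + (c−1)σb)`) and, over a valued field,
  **`valued_traceTorusElt_sub_one_le`**: `|a − 1|, |m − 1|, |c − 1| ≤ D`, `|b|, |σb| ≤ 1 ⇒` every entry of `t₁^{(b)} − 1` has `|·| ≤ D` — NO `|½| ≤ 1` (contrast ★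
  `TwoDeepRepresentativesTypeOneOrgans.valuation_flickerLiteralOne_sub_one_le (he : |e| ≤ 1)`): the trace literal loses no level at a dyadic place.

## References
* [Flicker1998UnitaryFL] Y. Z. Flicker, *Elementary proof of the fundamental lemma for a unitary group*, Canad. J. Math. 50 (1998), §2 Prop. 3 pp. 78–79, §3 p. 80 (`t₁`, `t_π`, the frame `h`).
* [Jacobowitz1962] R. Jacobowitz, *Hermitian forms over local fields*, Amer. J. Math. 84 (1962), §4 (4.2)–(4.4), §7 Thm. 7.1 (the trace condition `b + b̄ = 1` at an unramified dyadic place).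
* [Rogawski1990] J. D. Rogawski, *Automorphic Representations of Unitary Groups in Three Variables* (1990), §3.5 Prop. 3.5.2 p. 29, §3.6 p. 31 (sign vectors of frames).
-/

set_option autoImplicit false

noncomputable section

open Matrix
open scoped MatrixGroups

namespace Literature.NumberTheory.Rogawski1990

open Literature.NumberTheory.Automorphic

/-! ## §1 (T1)(T2) The trace frame `Q_b`: Gram `diag(1,1,−1)`, determinant `−(b + σb)`, integral inverse -/

section Ring

variable {R : Type*} [CommRing R] (σ : R →+* R)

/-- **(T1) EIGENVECTOR LENGTHS OF THE TRACE FRAME**: `ᵗσ(Q_b)·Φ₃·Q_b = diag(1, 1, −1)` for `Q_b = (1 0 1; 0 1 0; b 0 −σb)`, `σσ = id`, `b + σb = 1` — the columns `(1,0,b)`,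
`e₂`, `(1,0,−σb)` are `Φ₃`-orthogonal of lengths `b + σb = 1`, `1`, `−(b + σb) = −1` (contrast Flicker's `P₁`: `diag(−2, 1, 2)`, ★ `twistGram_flickerFrame`).
[cite: Jacobowitz1962, §4 (4.2)–(4.4)] [cite: Flicker1998UnitaryFL, §2 Prop. 3 p. 79] -/
theorem twistGram_traceFrame (hσσ : ∀ x, σ (σ x) = x) {b : R} (hb : b + σ b = 1) :
    twistGram σ (Matrix.of fun i j : Fin 3 => if i.val + j.val + 1 = 3 then (1 : R) else 0) !![(1 : R), 0, 1; 0, 1, 0; b, 0, -σ b] =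
      !![(1 : R), 0, 0; 0, 1, 0; 0, 0, -1] := by
  have hb' : σ b + b = 1 := by rw [add_comm]; exact hb
  rw [twistGram_def]
  ext i j
  fin_cases i <;> fin_cases j <;>
    simp [Matrix.mul_apply, Fin.sum_univ_three, Matrix.of_apply, map_neg, hσσ] <;> grind

/-- **`det Q_b = −(b + σb)`** (so `= −1` under the trace condition). [cite: Jacobowitz1962, §4 (4.2)–(4.4)] -/
theorem det_traceFrame (b : R) : Matrix.det !![(1 : R), 0, 1; 0, 1, 0; b, 0, -σ b] = -(b + σ b) := by
  simp [Matrix.det_fin_three]; ring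

/-- `det Q_b = −1` under `b + σb = 1`. [cite: Jacobowitz1962, §4 (4.2)–(4.4)] -/
theorem det_traceFrame_eq_neg_one {b : R} (hb : b + σ b = 1) : Matrix.det !![(1 : R), 0, 1; 0, 1, 0; b, 0, -σ b] = -1 := by
  rw [det_traceFrame, hb]

/-- **(T2) THE INTEGRAL INVERSE**: `Q_b · (σb 0 1; 0 1 0; b 0 −1) = 1` (`b + σb = 1`) — no `½` anywhere (contrast `P₁⁻¹ = (½ 0 −½; 0 1 0; ½ 0 ½)`).
[cite: Jacobowitz1962, §4 (4.2)–(4.4)] -/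
theorem traceFrame_mul_inv {b : R} (hb : b + σ b = 1) :
    !![(1 : R), 0, 1; 0, 1, 0; b, 0, -σ b] * !![σ b, 0, 1; 0, 1, 0; b, 0, -1] = 1 := by
  have hb' : σ b + b = 1 := by rw [add_comm]; exact hb
  ext i j
  fin_cases i <;> fin_cases j <;> simp [Matrix.mul_apply, Fin.sum_univ_three] <;> grind

/-- (T2) the reverse product `(σb 0 1; 0 1 0; b 0 −1) · Q_b = 1`. [cite: Jacobowitz1962, §4 (4.2)–(4.4)] -/
theorem inv_mul_traceFrame {b : R} (hb : b + σ b = 1) :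
    !![σ b, 0, 1; 0, 1, 0; b, 0, -1] * !![(1 : R), 0, 1; 0, 1, 0; b, 0, -σ b] = 1 := by
  have hb' : σ b + b = 1 := by rw [add_comm]; exact hb
  ext i j
  fin_cases i <;> fin_cases j <;> simp [Matrix.mul_apply, Fin.sum_univ_three] <;> grind

/-- (T2) `Q_b ∈ GL₃(R)` with the integral inverse: `∃ Q : GL (Fin 3) R, Q = Q_b ∧ Q⁻¹ = (σb 0 1; 0 1 0; b 0 −1)`. [cite: Jacobowitz1962, §4 (4.2)–(4.4)] -/
theorem exists_generalLinearGroup_traceFrame {b : R} (hb : b + σ b = 1) :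
    ∃ Q : GL (Fin 3) R, (Q : Matrix (Fin 3) (Fin 3) R) = !![(1 : R), 0, 1; 0, 1, 0; b, 0, -σ b] ∧
      ((Q⁻¹ : GL (Fin 3) R) : Matrix (Fin 3) (Fin 3) R) = !![σ b, 0, 1; 0, 1, 0; b, 0, -1] :=
  ⟨⟨_, _, traceFrame_mul_inv σ hb, inv_mul_traceFrame σ hb⟩, rfl, rfl⟩

/-! ## §2 (T3)(T4) The trace literal `t₁^{(b)} = Q_b·diag(a, m, c)·Q_b⁻¹`: eigenframe, unitarity, characteristic polynomial -/

/-- **(T3) EIGENFRAME**: `t₁^{(b)}·Q_b = Q_b·diag(a, m, c)` for `t₁^{(b)} = (aσb + cb, 0, a − c; 0, m, 0; bσb(a − c), 0, ab + cσb)` (`b + σb = 1`) — eigenvalue `a` on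
`(1,0,b)`, `m` on `e₂`, `c` on `(1,0,−σb)` (twin of ★ `flickerTorusElt_one_mul_frame`). [cite: Flicker1998UnitaryFL, §2 Prop. 3 pp. 78–79] -/
theorem traceTorusElt_mul_frame {b : R} (hb : b + σ b = 1) (a m c : R) :
    !![a * σ b + c * b, 0, a - c; 0, m, 0; b * σ b * (a - c), 0, a * b + c * σ b] * !![(1 : R), 0, 1; 0, 1, 0; b, 0, -σ b] =
      !![(1 : R), 0, 1; 0, 1, 0; b, 0, -σ b] * !![a, 0, 0; 0, m, 0; 0, 0, c] := by
  have hb' : σ b + b = 1 := by rw [add_comm]; exact hb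
  ext i j
  fin_cases i <;> fin_cases j <;> simp [Matrix.mul_apply, Fin.sum_univ_three] <;> grind

/-- (T3) `t₁^{(b)} = Q_b·diag(a, m, c)·(σb 0 1; 0 1 0; b 0 −1)` (the conjugate by the trace frame, with its integral inverse). [cite: Flicker1998UnitaryFL, §2 Prop. 3 pp. 78–79] -/
theorem traceTorusElt_eq_conj {b : R} (hb : b + σ b = 1) (a m c : R) :
    !![a * σ b + c * b, 0, a - c; 0, m, 0; b * σ b * (a - c), 0, a * b + c * σ b] =
      !![(1 : R), 0, 1; 0, 1, 0; b, 0, -σ b] * !![a, 0, 0; 0, m, 0; 0, 0, c] * !![σ b, 0, 1; 0, 1, 0; b, 0, -1] := by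
  rw [← traceTorusElt_mul_frame σ hb, Matrix.mul_assoc, traceFrame_mul_inv σ hb, Matrix.mul_one]

/-- **(T3) `t₁^{(b)} ∈ U(σ, Φ₃)`**: `ᵗσ(t₁^{(b)})·Φ₃·t₁^{(b)} = Φ₃` whenever `σσ = id`, `b + σb = 1` and `σ(a)a = σ(m)m = σ(c)c = 1` — the twin of ★ `flickerTorusElt_one_unitary`
with NO `2e = 1` and NO `σe = e` (the literal carries the pair `b, σb`). [cite: Flicker1998UnitaryFL, §2 Prop. 3 pp. 78–79; §3 p. 80] [cite: Jacobowitz1962, §7 Thm. 7.1] -/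
theorem traceTorusElt_unitary (hσσ : ∀ x, σ (σ x) = x) {b : R} (hb : b + σ b = 1) {a m c : R}
    (ha : σ a * a = 1) (hm : σ m * m = 1) (hc : σ c * c = 1) :
    ((!![a * σ b + c * b, 0, a - c; 0, m, 0; b * σ b * (a - c), 0, a * b + c * σ b]).map σ)ᵀ *
        (Matrix.of fun i j : Fin 3 => if i.val + j.val + 1 = 3 then (1 : R) else 0) *
        !![a * σ b + c * b, 0, a - c; 0, m, 0; b * σ b * (a - c), 0, a * b + c * σ b] =
      Matrix.of fun i j : Fin 3 => if i.val + j.val + 1 = 3 then (1 : R) else 0 := by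
  have hb' : σ b + b = 1 := by rw [add_comm]; exact hb
  ext i j
  fin_cases i <;> fin_cases j <;>
    simp [Matrix.mul_apply, Fin.sum_univ_three, Matrix.of_apply, map_add, map_sub, map_mul, hσσ] <;> grind

/-- **(T4) `charpoly t₁^{(b)} = (X − a)(X − m)(X − c)`** when `b + σb = 1` (then `det Q_b = −1` is a unit and `t₁^{(b)} = Q_b·diag·Q_b⁻¹`). [cite: Flicker1998UnitaryFL, §2 Prop. 3 pp. 78–79]
[cite: Rogawski1990, §3.1 p. 19] -/
theorem charpoly_traceTorusElt {b : R} (hb : b + σ b = 1) (a m c : R) :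
    (!![a * σ b + c * b, 0, a - c; 0, m, 0; b * σ b * (a - c), 0, a * b + c * σ b]).charpoly =
      (Polynomial.X - Polynomial.C a) * (Polynomial.X - Polynomial.C m) * (Polynomial.X - Polynomial.C c) := by
  obtain ⟨Q, hQ, hQi⟩ := exists_generalLinearGroup_traceFrame σ hb
  have ht : !![a * σ b + c * b, 0, a - c; 0, m, 0; b * σ b * (a - c), 0, a * b + c * σ b] =
      Q.val * !![a, 0, 0; 0, m, 0; 0, 0, c] * Q.val⁻¹ := by
    rw [traceTorusElt_eq_conj σ hb, ← hQ, ← hQi, Matrix.coe_units_inv]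
  rw [ht, Matrix.charpoly_units_conj, etaDiag_eq_diagonal, Matrix.charpoly_diagonal, Fin.prod_univ_three]
  rfl

/-! ## §3 (T5) The `π`-class: frame `diag(π,1,1)·Q_b` of lengths `(π, 1, −π)` and the literal `t_π^{(b)}` -/

/-- **(T5) `diag(π,1,1)·Q_b` has Gram `diag(π, 1, −π)`** (`σπ = π`, `σσ = id`, `b + σb = 1`): lengths `π(b + σb) = π`, `1`, `−π(b + σb) = −π` — relative to `Q_b` the ratios are
`(π, 1, π)`, the sign pattern `(1,0,1)` of Flicker's `t_π`, read on «`π ∉ N(E^×)`» alone (no `±2 ∈ N`). [cite: Rogawski1990, §3.5 Prop. 3.5.2 p. 29; §3.6 p. 31]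
[cite: Flicker1998UnitaryFL, §2 Prop. 3 p. 79] -/
theorem twistGram_diag_mul_traceFrame (hσσ : ∀ x, σ (σ x) = x) {b : R} (hb : b + σ b = 1) {π : R} (hσπ : σ π = π) :
    twistGram σ (Matrix.of fun i j : Fin 3 => if i.val + j.val + 1 = 3 then (1 : R) else 0) (!![π, 0, 0; 0, 1, 0; 0, 0, 1] * !![(1 : R), 0, 1; 0, 1, 0; b, 0, -σ b]) =
      !![π, 0, 0; 0, 1, 0; 0, 0, -π] := by
  have hb' : σ b + b = 1 := by rw [add_comm]; exact hb
  rw [twistGram_def]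
  ext i j
  fin_cases i <;> fin_cases j <;>
    simp [Matrix.mul_apply, Fin.sum_univ_three, Matrix.of_apply, map_neg, hσσ, hσπ] <;> grind

/-- **(T5) `t_π^{(b)}` is `diag(π,1,1)`-conjugate to `t₁^{(b)}`**: `diag(π,1,1)·t₁^{(b)} = t_π^{(b)}·diag(π,1,1)` with
`t_π^{(b)} = (aσb + cb, 0, π(a − c); 0, m, 0; π′bσb(a − c), 0, ab + cσb)`, `ππ′ = 1` (twin of ★ `diag_mul_flickerTorusElt_one`). [cite: Flicker1998UnitaryFL, §2 Prop. 3 p. 79] -/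
theorem diag_mul_traceTorusElt {π π' : R} (hπ : π * π' = 1) (b a m c : R) :
    !![π, 0, 0; 0, 1, 0; 0, 0, 1] * !![a * σ b + c * b, 0, a - c; 0, m, 0; b * σ b * (a - c), 0, a * b + c * σ b] =
      !![a * σ b + c * b, 0, π * (a - c); 0, m, 0; π' * (b * σ b * (a - c)), 0, a * b + c * σ b] * !![π, 0, 0; 0, 1, 0; 0, 0, 1] := by
  ext i j
  fin_cases i <;> fin_cases j <;> simp [Matrix.mul_apply, Fin.sum_univ_three] <;> grind

/-- **(T5) `t_π^{(b)} ∈ U(σ, Φ₃)`** for `σπ = π`, `σπ′ = π′`, `ππ′ = 1`, `σσ = id`, `b + σb = 1`, norm-one `a, m, c`. [cite: Flicker1998UnitaryFL, §2 Prop. 3 p. 79; §3 p. 80] -/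
theorem traceTorusEltPi_unitary (hσσ : ∀ x, σ (σ x) = x) {b : R} (hb : b + σ b = 1) {π π' : R} (hπ : π * π' = 1) (hσπ : σ π = π) (hσπ' : σ π' = π')
    {a m c : R} (ha : σ a * a = 1) (hm : σ m * m = 1) (hc : σ c * c = 1) :
    ((!![a * σ b + c * b, 0, π * (a - c); 0, m, 0; π' * (b * σ b * (a - c)), 0, a * b + c * σ b]).map σ)ᵀ *
        (Matrix.of fun i j : Fin 3 => if i.val + j.val + 1 = 3 then (1 : R) else 0) *
        !![a * σ b + c * b, 0, π * (a - c); 0, m, 0; π' * (b * σ b * (a - c)), 0, a * b + c * σ b] =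
      Matrix.of fun i j : Fin 3 => if i.val + j.val + 1 = 3 then (1 : R) else 0 := by
  have hb' : σ b + b = 1 := by rw [add_comm]; exact hb
  ext i j
  fin_cases i <;> fin_cases j <;>
    simp [Matrix.mul_apply, Fin.sum_univ_three, Matrix.of_apply, map_add, map_sub, map_mul, hσσ, hσπ, hσπ'] <;> grind

/-! ## §4 (T6) The depth of `t₁^{(b)} − 1` -/

/-- **(T6) `t₁^{(b)} − 1` entrywise**: `= ((a−1)σb + (c−1)b, 0, a − c; 0, m − 1, 0; bσb(a − c), 0, (a−1)b + (c−1)σb)` (`b + σb = 1`). [cite: Flicker1998UnitaryFL, §6 p. 95] -/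
theorem traceTorusElt_sub_one {b : R} (hb : b + σ b = 1) (a m c : R) :
    !![a * σ b + c * b, 0, a - c; 0, m, 0; b * σ b * (a - c), 0, a * b + c * σ b] - 1 =
      !![(a - 1) * σ b + (c - 1) * b, 0, a - c; 0, m - 1, 0; b * σ b * (a - c), 0, (a - 1) * b + (c - 1) * σ b] := by
  have hb' : σ b + b = 1 := by rw [add_comm]; exact hb
  ext i j
  fin_cases i <;> fin_cases j <;> simp <;> grind

end Ring

section Valued

variable {K : Type*} [Field K] {Γ₀ : Type*} [LinearOrderedCommGroupWithZero Γ₀] [Valued K Γ₀] (σ : K →+* K)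

/-- **(T6) DEPTH IS PRESERVED**: if `|a − 1|, |m − 1|, |c − 1| ≤ D` and `|b|, |σb| ≤ 1` (`b + σb = 1`) then every entry of `t₁^{(b)} − 1` has valuation `≤ D` — the twin of ★
`TwoDeepRepresentativesTypeOneOrgans.valuation_flickerLiteralOne_sub_one_le` WITHOUT `he : |e| ≤ 1` (at a dyadic place `|½| > 1` and Flicker's literal loses `ord 2` levels; the trace literal
loses none). [cite: Flicker1998UnitaryFL, §6 p. 95] [cite: Rogawski1990, §4.9 Prop. 4.9.1 (b) p. 55] -/
theorem valued_traceTorusElt_sub_one_le {b : K} (hb : b + σ b = 1) (hb1 : Valued.v b ≤ 1) (hσb1 : Valued.v (σ b) ≤ 1) {a m c : K} {D : Γ₀}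
    (ha : Valued.v (a - 1) ≤ D) (hm : Valued.v (m - 1) ≤ D) (hc : Valued.v (c - 1) ≤ D) :
    ∀ i j, Valued.v ((!![a * σ b + c * b, 0, a - c; 0, m, 0; b * σ b * (a - c), 0, a * b + c * σ b] - (1 : Matrix (Fin 3) (Fin 3) K)) i j) ≤ D := by
  have hac : Valued.v (a - c) ≤ D := by
    rw [show a - c = (a - 1) - (c - 1) by ring]
    exact (Valuation.map_sub _ _ _).trans (max_le ha hc)
  have h11 : Valued.v ((a - 1) * σ b + (c - 1) * b) ≤ D := by
    refine (Valuation.map_add _ _ _).trans (max_le ?_ ?_)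
    · rw [map_mul]; exact (mul_le_mul' ha hσb1).trans_eq (mul_one D)
    · rw [map_mul]; exact (mul_le_mul' hc hb1).trans_eq (mul_one D)
  have h33 : Valued.v ((a - 1) * b + (c - 1) * σ b) ≤ D := by
    refine (Valuation.map_add _ _ _).trans (max_le ?_ ?_)
    · rw [map_mul]; exact (mul_le_mul' ha hb1).trans_eq (mul_one D)
    · rw [map_mul]; exact (mul_le_mul' hc hσb1).trans_eq (mul_one D)
  have h31 : Valued.v (b * σ b * (a - c)) ≤ D := by
    rw [map_mul, map_mul]
    calc Valued.v b * Valued.v (σ b) * Valued.v (a - c) ≤ 1 * 1 * D := mul_le_mul' (mul_le_mul' hb1 hσb1) hac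
      _ = D := by rw [one_mul, one_mul]
  have h0 : Valued.v (0 : K) ≤ D := by rw [map_zero]; exact zero_le
  rw [traceTorusElt_sub_one σ hb]
  intro i j
  fin_cases i <;> fin_cases j
  · exact h11
  · exact h0
  · exact hac
  · exact h0
  · exact hm
  · exact h0
  · exact h31
  · exact h0
  · exact h33

end Valued

end Literature.NumberTheory.Rogawski1990

end
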